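import Summits.AtomisticToContinuum.HydrodynamicLimit.Theorems.OneSphereInfluenceAssembly
import HarnessLib

/-!
# Route `OneSphereInfluence`: the rule-crux `MeanVarianceReduction` (stmt-AtomisticToContinuum-15139)

`MeanVarianceReduction : ScoreLinearResponse → ResamplingInfluence → HardCorePoincare →
PreShockHomotopy → HydrodynamicLimit` is the assembly item `Assembly` (stmt-14700, proved in
`OneSphereInfluenceAssembly.lean`) with its `HomogeneousInvariance` hypothesis discharged by the
proved support `HomogeneousInvariance_holds` (stmt-9621). With it the route's deciding theorem
`closes` has only the three one-sphere cruxes and the pre-shock homotopy as hypotheses.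
-/

namespace Summit.AtomisticToContinuum.HydrodynamicLimit.Theorems

open Summit.AtomisticToContinuum.HydrodynamicLimit.Theses.OneSphereInfluence

/-- **Route `OneSphereInfluence`, rule-crux `MeanVarianceReduction` (stmt-AtomisticToContinuum-15139).**
The three one-sphere cruxes and the pre-shock homotopy imply the conjunct `HydrodynamicLimit`:
the assembly `oneSphereInfluence_assembly` with the proved flow-invariance of the homogeneous
canonical law `HomogeneousInvariance_holds`. [folklore] -/
theorem oneSphereInfluence_meanVarianceReduction :
    Summit.AtomisticToContinuum.HydrodynamicLimit.Theses.OneSphereInfluence.MeanVarianceReduction :=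
  fun h₂ h₃ h₄ hP => oneSphereInfluence_assembly h₂ h₃ h₄ HomogeneousInvariance_holds hP

end Summit.AtomisticToContinuum.HydrodynamicLimit.Theorems
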